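import Literature.NumberTheory.Automorphic.HyperspecialUnitarySatakeTransform
import Literature.NumberTheory.Automorphic.SatakeTransformGLIwasawaDatum
import HarnessLib

/-!
# The unramified unitary Satake transform is an instance of the abstract Iwasawa-datum transform
# (`hd.satakeTransform = hd.isIwasawaExponent.satakeTransform (q^{-⟨ν, ·⟩/2})`)

Topic `NumberTheory/Automorphic`; namespace `Literature.NumberTheory.Automorphic.HermitianLattice.UnramifiedLocalConjDatum`
(lane `lit-hodgefound`, Track 2 foundations; seat `lit-hodgefound-p11`, generation 37, row g37-#9).  One definition with body
(`borelLatticeU`) + theorems; no named fact, no instance, no notation.  BRIDGE between the tree's concrete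
`HyperspecialUnitarySatakeTransform` (`hd.iwasawaExp`, `hd.satakeVec`, `hd.satakeTransform` for the unramified unitary group
`U(σ, J₀) = unitaryGroupOfForm σ J₀`, `K₀ = unitaryInt`) and the abstract `SatakeTransformIwasawa` (`IsIwasawaExponent`,
`IsIwasawaExponent.satakeTransform`), through the weight homomorphism `satakeWeightHom` of `SatakeTransformGLIwasawaDatum`:
the unitary construction is the abstract one for the datum `P = {u · diag(ϖ^a) : u ∈ U(σ,J₀) unitriangular, a ∘ rev = -a}`,
`K₀`, `a = hd.iwasawaExp`, `w = (√q)^{-⟨ν, ·⟩}`.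

## The print

[CartierCorvallis1979] §IV (4.2), Thm. 4.1 (`G = PK`, `Sf(m) = δ(m)^{1/2} ∫_N f(mn) dn`, an algebra homomorphism — the proof
uses only `G = NAK` and the multiplicativity of `δ^{1/2}` on `A/A(𝒪) ≅ Λ`); [BruhatTits1972] §4.4 (4.4.3) (the Iwasawa
decomposition for the quasi-split unramified unitary group); [Minguez2011] §4 (unramified representations of unitary groups,
Satake parameters).  Nothing new is claimed: this file is the dictionary.

## What is formalised (`hd : UnramifiedLocalConjDatum σ ϖ` on a field `K` with `Valued K ℤᵐ⁰`; `J₀` antidiagonal of size `N`)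

* §1 **`hd.borelLatticeU ≤ U(σ, J₀)`** — the subgroup of products `u · t`, `u` unitary upper unitriangular, `t` unitary with
  `(t : GL_N) = diag(ϖ^a)`, `a ∘ rev = -a` (closed under products since `t u t⁻¹` is again unitriangular);
  `unipotent_mul_torus_mem_borelLatticeU`.
* §2 **`hd.isIwasawaExponent : IsIwasawaExponent hd.borelLatticeU K₀ hd.iwasawaExp`** (from `iwasawaExp_mul_of_mem_unitaryInt`,
  `iwasawaExp_unipotent_mul`, `iwasawaExp_zpowDiagGL_mul`, `exists_eq_unipotent_mul_zpowDiagGL_mul_unitaryInt`).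
* §3 **`hd.satakeVec_eq_isIwasawaExponent_satakeVec`**, **`hd.satakeTransform_eq_isIwasawaExponent_satakeTransform`** (weight
  `satakeWeightHom (residueCardSqrt K) _`), and transported corollaries `hd.satakeTransform_eq_monomialTwist_comp`
  (`𝒮 = twist ∘ 𝒮_1`), `hd.coeff_satakeTransform_doubleCosetOperator` (the coefficient of `x^μ` in `𝒮(T_g)` is
  `#{α ∈ K₀gK₀/K₀ : a(α) = μ} · (√q)^{-⟨ν, μ⟩}` — new for `U`), `hd.coeff_satakeTransform_doubleCosetOperator_eq_zero`.

## References
* [CartierCorvallis1979] P. Cartier, *Representations of 𝔭-adic groups: a survey*, PSPM 33.1 (1979), §IV (4.2), Thm. 4.1.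
* [BruhatTits1972] F. Bruhat, J. Tits, Publ. Math. IHÉS 41 (1972), §4.4 (4.4.3).
* [Minguez2011] A. Mínguez, *Unramified representations of unitary groups*, in: *On the stabilization of the trace formula*
  (2011), §4.
-/

noncomputable section

open scoped Valued WithZero Matrix MatrixGroups
open MonoidAlgebra Representation

namespace Literature.NumberTheory.Automorphic.HermitianLattice

open Literature.NumberTheory.Automorphic.CartanUnique Literature.NumberTheory.Automorphic.SymplecticCartan

variable {K : Type*} [Field K] [Valued K ℤᵐ⁰] {σ : K →+* K} {ϖ : K} {N : ℕ}

namespace UnramifiedLocalConjDatum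

/-! ## §1 The subgroup `P = {u · diag(ϖ^a)}` of `U(σ, J₀)` -/

/-- **The subgroup `P = N·A_Λ ≤ U(σ, J₀)`** of products `u · t` with `u ∈ U(σ, J₀)` upper unitriangular and `t ∈ U(σ, J₀)` a
lattice torus element, `(t : GL_N) = diag(ϖ^{a})`, `a ∘ rev = -a`: Cartier's `P = AN` with the torus restricted to `ϖ^{Λ}`.
[cite: CartierCorvallis1979, §IV (4.2)] [cite: BruhatTits1972, §4.4 (4.4.3)] -/
def borelLatticeU (hd : UnramifiedLocalConjDatum σ ϖ) : Subgroup (unitaryGroupOfForm σ ((StdForm.antidiagonal N).over K)) where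
  carrier := {g | ∃ u t : unitaryGroupOfForm σ ((StdForm.antidiagonal N).over K),
    (u : GL (Fin N) K) ∈ upperUnitriangular (Fin N) K ∧
      (∃ a : Fin N → ℤ, (∀ i, a (Fin.rev i) = -a i) ∧ (t : GL (Fin N) K) = zpowDiagGL (uniformizer_ne_zero hd.vϖ) a) ∧
        g = u * t}
  one_mem' := ⟨1, 1, by rw [OneMemClass.coe_one]; exact (upperUnitriangular (Fin N) K).one_mem,
    ⟨0, fun _ => by rw [Pi.zero_apply, Pi.zero_apply, neg_zero], by rw [OneMemClass.coe_one, zpowDiagGL_zero]⟩,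
    (mul_one _).symm⟩
  mul_mem' := by
    rintro _ _ ⟨u, t, hu, ⟨a, ha, ht⟩, rfl⟩ ⟨u', t', hu', ⟨a', ha', ht'⟩, rfl⟩
    refine ⟨u * (t * u' * t⁻¹), t * t', ?_, ⟨a + a', fun i => ?_, ?_⟩, by group⟩
    · rw [Subgroup.coe_mul, Subgroup.coe_mul, Subgroup.coe_mul, Subgroup.coe_inv, ht]
      exact (upperUnitriangular (Fin N) K).mul_mem hu (zpowDiagGL_mul_mul_inv_mem_upperUnitriangular _ a hu')
    · rw [Pi.add_apply, Pi.add_apply, ha, ha', neg_add]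
    · rw [Subgroup.coe_mul, ht, ht', zpowDiagGL_add]
  inv_mem' := by
    rintro _ ⟨u, t, hu, ⟨a, ha, ht⟩, rfl⟩
    have htinv : ((t⁻¹ : unitaryGroupOfForm σ ((StdForm.antidiagonal N).over K)) : GL (Fin N) K) =
        zpowDiagGL (uniformizer_ne_zero hd.vϖ) (-a) := by
      rw [Subgroup.coe_inv, ht, zpowDiagGL_neg]
    refine ⟨t⁻¹ * u⁻¹ * t, t⁻¹, ?_, ⟨-a, fun i => ?_, htinv⟩, by group⟩
    · have ht' : ((t : unitaryGroupOfForm σ ((StdForm.antidiagonal N).over K)) : GL (Fin N) K) =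
          (zpowDiagGL (uniformizer_ne_zero hd.vϖ) (-a))⁻¹ := by
        rw [zpowDiagGL_neg, inv_inv, ht]
      rw [Subgroup.coe_mul, Subgroup.coe_mul, htinv, ht', Subgroup.coe_inv]
      exact zpowDiagGL_mul_mul_inv_mem_upperUnitriangular _ (-a) ((upperUnitriangular (Fin N) K).inv_mem hu)
    · rw [Pi.neg_apply, Pi.neg_apply, ha]

/-- `u · t ∈ P` for `u` unitriangular and `t = diag(ϖ^a)`, `a ∘ rev = -a`. [cite: CartierCorvallis1979, §IV (4.2)] -/
theorem unipotent_mul_torus_mem_borelLatticeU (hd : UnramifiedLocalConjDatum σ ϖ)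
    {u t : unitaryGroupOfForm σ ((StdForm.antidiagonal N).over K)} (hu : (u : GL (Fin N) K) ∈ upperUnitriangular (Fin N) K)
    {a : Fin N → ℤ} (ha : ∀ i, a (Fin.rev i) = -a i) (ht : (t : GL (Fin N) K) = zpowDiagGL (uniformizer_ne_zero hd.vϖ) a) :
    u * t ∈ hd.borelLatticeU :=
  ⟨u, t, hu, ⟨a, ha, ht⟩, rfl⟩

/-- `a(u · t) = a` for `u · t ∈ P` with `(t : GL_N) = diag(ϖ^a)`. [cite: BruhatTits1972, §4.4 (4.4.3)] -/
theorem iwasawaExp_unipotent_mul_torus (hd : UnramifiedLocalConjDatum σ ϖ)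
    {u t : unitaryGroupOfForm σ ((StdForm.antidiagonal N).over K)} (hu : (u : GL (Fin N) K) ∈ upperUnitriangular (Fin N) K)
    {a : Fin N → ℤ} (ht : (t : GL (Fin N) K) = zpowDiagGL (uniformizer_ne_zero hd.vϖ) a) :
    hd.iwasawaExp (u * t) = a :=
  hd.iwasawaExp_eq hu ht (unitaryInt σ _).one_mem (mul_one _).symm

/-- **Additivity on `P`**: `a((u t) g) = a + a(g)` for `(t : GL_N) = diag(ϖ^a)`, `a ∘ rev = -a`. [cite: BruhatTits1972, §4.4 (4.4.3)]
[cite: CartierCorvallis1979, §IV Thm. 4.1] -/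
theorem iwasawaExp_unipotent_mul_torus_mul (hd : UnramifiedLocalConjDatum σ ϖ)
    {u t : unitaryGroupOfForm σ ((StdForm.antidiagonal N).over K)} (hu : (u : GL (Fin N) K) ∈ upperUnitriangular (Fin N) K)
    {a : Fin N → ℤ} (ha : ∀ i, a (Fin.rev i) = -a i) (ht : (t : GL (Fin N) K) = zpowDiagGL (uniformizer_ne_zero hd.vϖ) a)
    (g : unitaryGroupOfForm σ ((StdForm.antidiagonal N).over K)) :
    hd.iwasawaExp (u * t * g) = a + hd.iwasawaExp g := by
  have hteq : t = ⟨zpowDiagGL (uniformizer_ne_zero hd.vϖ) a, zpowDiagGL_mem_unitaryGroupOfForm hd.σϖ _ ha⟩ :=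
    Subtype.ext ht
  rw [mul_assoc, hd.iwasawaExp_unipotent_mul hu, hteq, hd.iwasawaExp_zpowDiagGL_mul ha]

/-! ## §2 The Iwasawa datum of `U(σ, J₀)` -/

/-- **THE IWASAWA DATUM OF THE UNRAMIFIED UNITARY GROUP**: `hd.iwasawaExp` is an Iwasawa exponent for `(P, K₀)` — right
`K₀`-invariant, left `P`-additive, `U(σ, J₀) = P · K₀`. [cite: BruhatTits1972, §4.4 (4.4.3)] [cite: CartierCorvallis1979, §IV (4.2)] -/
theorem isIwasawaExponent (hd : UnramifiedLocalConjDatum σ ϖ) :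
    IsIwasawaExponent hd.borelLatticeU (unitaryInt σ ((StdForm.antidiagonal N).over K)) (hd.iwasawaExp (N := N)) where
  mul_of_mem_right g _ hk := hd.iwasawaExp_mul_of_mem_unitaryInt g hk
  mul_of_mem_left := by
    rintro _ ⟨u, t, hu, ⟨a, ha, ht⟩, rfl⟩ g
    rw [hd.iwasawaExp_unipotent_mul_torus_mul hu ha ht g, hd.iwasawaExp_unipotent_mul_torus hu ht]
  exists_eq_mul g := by
    obtain ⟨u, t, k, a, hu, ha, ht, hk, hg⟩ := hd.exists_eq_unipotent_mul_zpowDiagGL_mul_unitaryInt g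
    exact ⟨u * t, hd.unipotent_mul_torus_mem_borelLatticeU hu ha ht, k, hk, hg⟩

/-! ## §3 The unitary transform is the abstract transform -/

/-- **`hd.satakeVec = IsIwasawaExponent.satakeVec`** for the unitary datum and the weight `(√q)^{-⟨ν,·⟩}`.
[cite: CartierCorvallis1979, §IV (4.2)] -/
theorem satakeVec_eq_isIwasawaExponent_satakeVec (hd : UnramifiedLocalConjDatum σ ϖ) [Finite 𝓀[K]] :
    hd.satakeVec (N := N) = IsIwasawaExponent.satakeVec (unitaryInt σ ((StdForm.antidiagonal N).over K)) hd.iwasawaExp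
      (satakeWeightHom (residueCardSqrt K) residueCardSqrt_ne_zero) := by
  refine LinearMap.ext fun x => ?_
  rw [hd.satakeVec_apply, IsIwasawaExponent.satakeVec_apply]
  rfl

variable [Finite 𝓀[K]]

/-- **THE UNITARY SATAKE TRANSFORM IS THE ABSTRACT ONE**: `hd.satakeTransform = hd.isIwasawaExponent.satakeTransform w`,
`w = (√q)^{-⟨ν, ·⟩}`. [cite: CartierCorvallis1979, §IV (4.2), Thm. 4.1] [cite: Minguez2011, §4] -/
theorem satakeTransform_eq_isIwasawaExponent_satakeTransform (hd : UnramifiedLocalConjDatum σ ϖ) :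
    hd.satakeTransform (N := N) =
      hd.isIwasawaExponent.satakeTransform (satakeWeightHom (residueCardSqrt K) residueCardSqrt_ne_zero) := by
  refine AlgHom.ext fun T => ?_
  rw [hd.satakeTransform_apply, IsIwasawaExponent.satakeTransform_apply, hd.satakeVec_eq_isIwasawaExponent_satakeVec]

/-- Transported: **`𝒮 = monomialTwist ((√q)^{-⟨ν,·⟩}) ∘ 𝒮_1`**. [cite: CartierCorvallis1979, §IV (4.2)] -/
theorem satakeTransform_eq_monomialTwist_comp (hd : UnramifiedLocalConjDatum σ ϖ) :
    hd.satakeTransform (N := N) =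
      (monomialTwist (satakeWeightHom (residueCardSqrt K) residueCardSqrt_ne_zero)).comp
        (hd.isIwasawaExponent.satakeTransform 1) := by
  rw [hd.satakeTransform_eq_isIwasawaExponent_satakeTransform]
  exact hd.isIwasawaExponent.satakeTransform_eq_monomialTwist_comp _

variable [IsHeckeTriple (⊤ : Submonoid (unitaryGroupOfForm σ ((StdForm.antidiagonal N).over K)))
  (unitaryInt σ ((StdForm.antidiagonal N).over K)) (unitaryInt σ ((StdForm.antidiagonal N).over K))]

/-- Transported **coefficient formula**: the coefficient of `x^μ` in `𝒮(T_g)` is `#{α ∈ K₀gK₀/K₀ : a(α) = μ} · (√q)^{-⟨ν, μ⟩}`.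
[cite: CartierCorvallis1979, §IV (4.2)] -/
theorem coeff_satakeTransform_doubleCosetOperator (hd : UnramifiedLocalConjDatum σ ϖ)
    (g : unitaryGroupOfForm σ ((StdForm.antidiagonal N).over K)) (μ : Fin N → ℤ)
    [DecidablePred fun α : unitaryGroupOfForm σ ((StdForm.antidiagonal N).over K) ⧸
      unitaryInt σ ((StdForm.antidiagonal N).over K) => hd.iwasawaExp α.out = μ] :
    (hd.satakeTransform (heckeAlgebra.doubleCosetOperator (unitaryInt σ ((StdForm.antidiagonal N).over K)) g)).coeff μ =
      (((finite_orbit_quotient (unitaryInt σ ((StdForm.antidiagonal N).over K)) g).toFinset.filter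
          fun α => hd.iwasawaExp α.out = μ).card : ℂ) * satakeWeight (residueCardSqrt K) μ := by
  rw [hd.satakeTransform_eq_isIwasawaExponent_satakeTransform, IsIwasawaExponent.coeff_satakeTransform_doubleCosetOperator,
    satakeWeightHom_ofAdd]

/-- Transported **vanishing**: `x^μ` does not occur in `𝒮(T_g)` unless some `α ∈ K₀gK₀/K₀` has `a(α) = μ`.
[cite: CartierCorvallis1979, §IV (4.2)] -/
theorem coeff_satakeTransform_doubleCosetOperator_eq_zero (hd : UnramifiedLocalConjDatum σ ϖ)
    {g : unitaryGroupOfForm σ ((StdForm.antidiagonal N).over K)} {μ : Fin N → ℤ}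
    (h : ∀ α : unitaryGroupOfForm σ ((StdForm.antidiagonal N).over K) ⧸ unitaryInt σ ((StdForm.antidiagonal N).over K),
      α ∈ MulAction.orbit (unitaryInt σ ((StdForm.antidiagonal N).over K))
        (g : unitaryGroupOfForm σ ((StdForm.antidiagonal N).over K) ⧸ unitaryInt σ ((StdForm.antidiagonal N).over K)) →
      hd.iwasawaExp α.out ≠ μ) :
    (hd.satakeTransform (heckeAlgebra.doubleCosetOperator (unitaryInt σ ((StdForm.antidiagonal N).over K)) g)).coeff μ = 0 := by
  rw [hd.satakeTransform_eq_isIwasawaExponent_satakeTransform]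
  exact hd.isIwasawaExponent.coeff_satakeTransform_doubleCosetOperator_eq_zero _ h

end UnramifiedLocalConjDatum

end Literature.NumberTheory.Automorphic.HermitianLattice

end
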